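import Literature.Analysis.FluidPDE.PassiveScalarClassicalEnergy
import Literature.Analysis.FluidPDE.PassiveScalarRenormalizedSlice
import Literature.Analysis.FunctionSpaces.TorusSpaceTimeComposition
import Mathlib.Analysis.SpecialFunctions.Sqrt
import Mathlib.Analysis.Calculus.MeanValue

/-!
# Convex (renormalised) Lyapunov functionals of classical passive scalars: `∫ β(θ)`,
# the `L¹` norm and the positive part are non-increasing

Topic `Literature/Analysis/FluidPDE` (passive-scalar cluster; theorems only, no definitions, no
named facts). For a classical (jointly smooth) solution `θ` of the advection–diffusion equation
`∂ₜθ + u·∇θ = κΔθ`, `div u = 0`, on `S × T^d` (`Torus.IsClassicalScalarTransportOn S κ u θ`,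
`PassiveScalar.lean`) and a smooth function `β : ℝ → ℝ`:

* `IsClassicalScalarTransportOn.hasDerivWithinAt_integral_comp` — the **renormalised balance**
  `d/dt ∫ β(θ(t)) = -κ ∫ β″(θ(t)) ‖∇θ(t)‖²` within a convex time set (chain rule in time,
  the equation, and the two integrations by parts on `T^d` already in the tree:
  `∫ β′(θ) ⟪u, ∇θ⟫ = 0` for divergence-free `u` (`β′(θ)∇θ = ∇(β ∘ θ)`) and
  `∫ β′(θ) Δθ = -∫ β″(θ) ‖∇θ‖²`, `Torus.integral_deriv_comp_mul_laplacian`). This is the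
  classical case of the DiPerna–Lions renormalisation (Invent. Math. 98 (1989), §II.3: the
  equation satisfied by `β(θ)`), of which the tree's `PassiveScalarClassicalEnergy`
  (`β(s) = s²`) is the quadratic instance;
* `IsClassicalScalarTransportOn.antitoneOn_integral_comp` — for `κ ≥ 0` and CONVEX smooth `β`
  (`β″ ≥ 0`) the functional `t ↦ ∫ β(θ(t))` is non-increasing on every `[a, b] ⊆ S`;
* by the smooth convex approximations `√(s² + ε²) → |s|` and `(s + √(s² + ε²))/2 → s⁺`
  (uniformly, error `≤ ε`), the non-smooth convex functionals follow:
  `IsClassicalScalarTransportOn.antitoneOn_integral_abs` — **the `L¹` norm `∫ |θ(t)|` is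
  non-increasing** (Gallay–Wayne 2005, Lemma 3.1, first assertion, there for the vorticity of the
  two-dimensional Navier–Stokes equation on `ℝ²` in `L¹`, "nonincreasing due to the maximum
  principle"; here its periodic classical twin in any dimension),
  `IsClassicalScalarTransportOn.antitoneOn_integral_posPart_sub` /
  `…antitoneOn_integral_posPart` — **the co-signed mass `∫ (θ(t) - c)⁺`, in particular `∫ θ(t)⁺`,
  is non-increasing**, and `IsClassicalScalarTransportOn.antitoneOn_integral_negPart` — so is
  `∫ θ(t)⁻` (the mean `∫ θ` being conserved): transport and diffusion only CANCEL the two signed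
  masses against each other (the order-preservation / `L¹`-contraction pairing of Crandall–Tartar
  1980 for mass-preserving maps); `IsClassicalScalarTransportOn.sub` /
  `…antitoneOn_integral_abs_sub` — the difference of two solutions with the same drift is a
  solution, hence the **`L¹`-contraction** `∫ |θ₁(t) - θ₂(t)| ↓`.

Reading for 2-D Navier–Stokes (census «H_ν» of the cell `ns-blowup`, (iii) theorem side): the
scalar vorticity `ω` of a classical solution of the two-dimensional Navier–Stokes equation is a
classical passive scalar of its own velocity with `κ = ν` (no stretching term; Majda–Bertozzi
2002, (2.6); tree: `IsClassicalNSSolutionOn.planarVorticity_eq` on `ℝ²`,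
`PlanarVorticityTransport.lean`), so on `T²` the theorems say: viscosity never increases the
co-signed flux `∫ ω⁺` nor `∫ |ω|` — it only pools and cancels vorticity. Nothing of the kind is
asserted in three dimensions (the stretching term `(ω·∇)u` has no sign).

## References

* R. J. DiPerna, P.-L. Lions, *Ordinary differential equations, transport theory and Sobolev
  spaces*, Invent. Math. 98 (1989), 511–547, §II.3 (renormalisation: the equation for `β(u)`).
  [`DiPernaLions1989`]
* Th. Gallay, C. E. Wayne, *Global stability of vortex solutions of the two-dimensional
  Navier–Stokes equation*, Comm. Math. Phys. 255 (2005), 97–129 = arXiv:math/0402449, §3.1,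
  Lemma 3.1 (held text p. 11: `Φ(w) = ∫ |w|` is non-increasing). [`GallayWayne2005`]
* M. G. Crandall, L. Tartar, *Some relations between nonexpansive and order preserving mappings*,
  Proc. Amer. Math. Soc. 78 (1980), 385–390. [`CrandallTartar1980`]
* A. J. Majda, A. L. Bertozzi, *Vorticity and Incompressible Flow*, CUP (2002), §2.1, (2.6).
  [`MajdaBertozzi2002`]
-/

open MeasureTheory Set Filter
open _root_.Topology
open scoped InnerProductSpace ContDiff

noncomputable section

namespace Literature.Analysis.FluidPDE

namespace Torus

variable {d : Type*} [Fintype d] [DecidableEq d]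

/-! ## Smooth convex approximations of `|s|` and `s⁺` -/

section Approximants

/-
The two approximants are written out in full everywhere (no auxiliary definitions, so that the
file stays theorem-only): the smooth absolute value `A_ε(s) = √(s² + ε²)` and the smooth positive
part `P_ε(s) = (s + √(s² + ε²))/2`.
-/

/-- `s² + ε² > 0` for `ε ≠ 0`. [folklore] -/
private theorem sq_add_sq_pos {ε : ℝ} (hε : ε ≠ 0) (s : ℝ) : 0 < s ^ 2 + ε ^ 2 := by
  have := sq_nonneg s
  have := pow_pos (abs_pos.2 hε) 2
  rw [sq_abs] at this
  linarith

/-- `√(s² + ε²) > 0` for `ε ≠ 0`. [folklore] -/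
private theorem smoothAbs_pos {ε : ℝ} (hε : ε ≠ 0) (s : ℝ) : 0 < Real.sqrt (s ^ 2 + ε ^ 2) :=
  Real.sqrt_pos.2 (sq_add_sq_pos hε s)

/-- `s ↦ √(s² + ε²)` is smooth for `ε ≠ 0`. [folklore] -/
private theorem contDiff_smoothAbs {ε : ℝ} (hε : ε ≠ 0) : ContDiff ℝ ∞ (fun s => Real.sqrt (s ^ 2 + ε ^ 2)) := by
  exact ((contDiff_id.pow 2).add contDiff_const).sqrt fun s => (sq_add_sq_pos hε s).ne'

/-- `s ↦ (s + √(s² + ε²))/2` is smooth for `ε ≠ 0`. [folklore] -/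
private theorem contDiff_smoothPos {ε : ℝ} (hε : ε ≠ 0) : ContDiff ℝ ∞ (fun s => (s + Real.sqrt (s ^ 2 + ε ^ 2)) / 2) := by
  exact (contDiff_id.add (contDiff_smoothAbs hε)).div_const 2

/-- `d/ds √(s² + ε²) = s / √(s² + ε²)`. [folklore] -/
private theorem hasDerivAt_smoothAbs {ε : ℝ} (hε : ε ≠ 0) (s : ℝ) :
    HasDerivAt (fun s => Real.sqrt (s ^ 2 + ε ^ 2)) (s / Real.sqrt (s ^ 2 + ε ^ 2)) s := by
  have h1 : HasDerivAt (fun s : ℝ => s ^ 2 + ε ^ 2) (2 * s) s := by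
    simpa using ((hasDerivAt_id s).pow 2).add_const (ε ^ 2)
  have h2 := h1.sqrt (sq_add_sq_pos hε s).ne'
  convert h2 using 1
  field_simp

/-- `(√(s² + ε²))′ = s/√(s² + ε²)` as a function. [folklore] -/
private theorem deriv_smoothAbs {ε : ℝ} (hε : ε ≠ 0) :
    deriv (fun s => Real.sqrt (s ^ 2 + ε ^ 2)) = fun s => s / Real.sqrt (s ^ 2 + ε ^ 2) :=
  funext fun s => (hasDerivAt_smoothAbs hε s).deriv

/-- `d²/ds² √(s² + ε²) = ε² / (√(s² + ε²))³`. [folklore] -/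
private theorem hasDerivAt_deriv_smoothAbs {ε : ℝ} (hε : ε ≠ 0) (s : ℝ) :
    HasDerivAt (deriv (fun s => Real.sqrt (s ^ 2 + ε ^ 2))) (ε ^ 2 / Real.sqrt (s ^ 2 + ε ^ 2) ^ 3) s := by
  rw [deriv_smoothAbs hε]
  have hg := hasDerivAt_smoothAbs hε s
  have hpos := smoothAbs_pos hε s
  have hsq : Real.sqrt (s ^ 2 + ε ^ 2) ^ 2 = s ^ 2 + ε ^ 2 := by
    rw [Real.sq_sqrt (sq_add_sq_pos hε s).le]
  have h : HasDerivAt (fun y => y / Real.sqrt (y ^ 2 + ε ^ 2))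
      ((1 * Real.sqrt (s ^ 2 + ε ^ 2) - s * (s / Real.sqrt (s ^ 2 + ε ^ 2))) / Real.sqrt (s ^ 2 + ε ^ 2) ^ 2) s :=
    (hasDerivAt_id s).div hg hpos.ne'
  refine h.congr_deriv ?_
  have e : 1 * Real.sqrt (s ^ 2 + ε ^ 2) - s * (s / Real.sqrt (s ^ 2 + ε ^ 2)) = ε ^ 2 / Real.sqrt (s ^ 2 + ε ^ 2) := by
    field_simp
    nlinarith [hsq]
  rw [e, div_div, ← pow_succ']

/-- Convexity of `√(s² + ε²)`: its second derivative is `≥ 0`. [folklore] -/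
private theorem deriv_deriv_smoothAbs_nonneg {ε : ℝ} (hε : ε ≠ 0) (s : ℝ) :
    0 ≤ deriv (deriv (fun s => Real.sqrt (s ^ 2 + ε ^ 2))) s := by
  rw [(hasDerivAt_deriv_smoothAbs hε s).deriv]
  exact div_nonneg (sq_nonneg ε) (pow_nonneg (smoothAbs_pos hε s).le 3)

/-- `((s + √(s² + ε²))/2)′ = (1 + (√(s² + ε²))′)/2`. [folklore] -/
private theorem deriv_smoothPos {ε : ℝ} (hε : ε ≠ 0) :
    deriv (fun s => (s + Real.sqrt (s ^ 2 + ε ^ 2)) / 2) = fun s => (1 + deriv (fun s => Real.sqrt (s ^ 2 + ε ^ 2)) s) / 2 := by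
  funext s
  have h : HasDerivAt (fun s => (s + Real.sqrt (s ^ 2 + ε ^ 2)) / 2) ((1 + s / Real.sqrt (s ^ 2 + ε ^ 2)) / 2) s := by
    exact ((hasDerivAt_id s).add (hasDerivAt_smoothAbs hε s)).div_const 2
  rw [h.deriv, deriv_smoothAbs hε]

/-- Convexity of `(s + √(s² + ε²))/2`: its second derivative is `≥ 0`. [folklore] -/
private theorem deriv_deriv_smoothPos_nonneg {ε : ℝ} (hε : ε ≠ 0) (s : ℝ) :
    0 ≤ deriv (deriv (fun s => (s + Real.sqrt (s ^ 2 + ε ^ 2)) / 2)) s := by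
  rw [deriv_smoothPos hε]
  have h : HasDerivAt (fun s => (1 + deriv (fun s => Real.sqrt (s ^ 2 + ε ^ 2)) s) / 2)
      ((0 + ε ^ 2 / Real.sqrt (s ^ 2 + ε ^ 2) ^ 3) / 2) s :=
    ((hasDerivAt_const s (1 : ℝ)).add (hasDerivAt_deriv_smoothAbs hε s)).div_const 2
  rw [h.deriv, zero_add]
  exact div_nonneg (div_nonneg (sq_nonneg ε) (pow_nonneg (smoothAbs_pos hε s).le 3)) zero_le_two

/-- `|s| ≤ √(s² + ε²)`. [folklore] -/
private theorem abs_le_smoothAbs (ε s : ℝ) : |s| ≤ Real.sqrt (s ^ 2 + ε ^ 2) :=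
  Real.abs_le_sqrt (by nlinarith [sq_nonneg ε])

/-- `√(s² + ε²) ≤ |s| + |ε|`. [folklore] -/
private theorem smoothAbs_le (ε s : ℝ) : Real.sqrt (s ^ 2 + ε ^ 2) ≤ |s| + |ε| := by
  rw [Real.sqrt_le_left (by positivity)]
  nlinarith [abs_nonneg s, abs_nonneg ε, sq_abs s, sq_abs ε]

/-- `s⁺ ≤ (s + √(s² + ε²))/2`. [folklore] -/
private theorem posPart_le_smoothPos (ε s : ℝ) : s⁺ ≤ ((s + Real.sqrt (s ^ 2 + ε ^ 2)) / 2) := by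
  have h := abs_le_smoothAbs ε s
  rw [posPart_eq_ite]
  split_ifs with hs
  · rw [abs_of_nonneg hs] at h; linarith
  · rw [abs_of_neg (lt_of_not_ge hs)] at h; linarith

/-- `(s + √(s² + ε²))/2 ≤ s⁺ + |ε|/2`. [folklore] -/
private theorem smoothPos_le (ε s : ℝ) : ((s + Real.sqrt (s ^ 2 + ε ^ 2)) / 2) ≤ s⁺ + |ε| / 2 := by
  have h := smoothAbs_le ε s
  rw [posPart_eq_ite]
  split_ifs with hs
  · rw [abs_of_nonneg hs] at h; linarith
  · rw [abs_of_neg (lt_of_not_ge hs)] at h; linarith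

end Approximants

/-! ## The renormalised balance and its sign -/

namespace IsClassicalScalarTransportOn

variable {S : Set ℝ} {κ : ℝ} {u : ℝ → UnitAddTorus d → EuclideanSpace ℝ d}
  {θ : ℝ → UnitAddTorus d → ℝ}

/-- **Renormalised balance for classical passive scalars.** For a classical solution of
`∂ₜθ + u·∇θ = κΔθ`, `div u = 0`, on a convex time set `S` and a smooth `β : ℝ → ℝ`,
`d/dt ∫ β(θ(t)) = -κ ∫ β″(θ(t)) ‖∇θ(t)‖²` within `S` (differentiate under `∫_{T^d}`, chain
rule, the equation; the transport term `∫ β′(θ)⟪u, ∇θ⟫ = ∫ ⟪u, ∇(β∘θ)⟫` vanishes by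
incompressibility and `∫ β′(θ)Δθ = -∫ β″(θ)‖∇θ‖²` by Green's identity on `T^d`). The classical
case of the DiPerna–Lions renormalisation (the equation for `β(θ)`, integrated over the torus);
`β(s) = s²` is the tree's `hasDerivWithinAt_scalarL2Sq_holds`. At an isolated point of `S` the
statement is vacuous. [cite: DiPernaLions1989, §II.3] -/
theorem hasDerivWithinAt_integral_comp (h : IsClassicalScalarTransportOn S κ u θ)
    (hS : Convex ℝ S) {β : ℝ → ℝ} (hβ : ContDiff ℝ ∞ β) {t : ℝ} (ht : t ∈ S) :
    HasDerivWithinAt (fun s => ∫ x, β (θ s x))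
      (-κ * ∫ x, deriv (deriv β) (θ t x) * ‖FunctionSpaces.Torus.gradient (θ t) x‖ ^ 2) S t := by
  by_cases hacc : AccPt t (𝓟 S)
  swap
  · exact HasFDerivWithinAt.of_not_accPt hacc
  have hU : UniqueDiffOn ℝ S :=
    uniqueDiffOn_convex hS (FunctionSpaces.Torus.interior_nonempty_of_convex_of_accPt hS ht hacc)
  have hθs := h.smooth_scalar
  have hθt : FunctionSpaces.Torus.IsSmooth (θ t) := hθs.isSmooth_slice ht
  have hut : FunctionSpaces.Torus.IsSmooth (u t) := h.smooth_velocity.isSmooth_slice ht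
  have hβ' : ContDiff ℝ ∞ (deriv β) := (contDiff_infty_iff_deriv.1 hβ).2
  -- differentiate `∫ β(θ)` under the integral sign
  have hφ : FunctionSpaces.Torus.IsSmoothSpaceTimeOn S (fun s x => β (θ s x)) :=
    hθs.comp_contDiff hβ
  have hE := hφ.hasDerivWithinAt_integral hS ht
  have htd : ∀ x, FunctionSpaces.Torus.timeDerivWithin S (fun s x => β (θ s x)) t x =
      deriv β (θ t x) * FunctionSpaces.Torus.timeDerivWithin S θ t x := by
    intro x
    have h1 : HasDerivWithinAt (fun τ => θ τ x) (FunctionSpaces.Torus.timeDerivWithin S θ t x) S t :=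
      hθs.hasDerivWithinAt_slice ht x
    have h2 : HasDerivAt β (deriv β (θ t x)) (θ t x) :=
      ((hβ.differentiable (by simp)) _).hasDerivAt
    have h3 : HasDerivWithinAt (fun τ => β (θ τ x))
        (deriv β (θ t x) * FunctionSpaces.Torus.timeDerivWithin S θ t x) S t :=
      h2.comp_hasDerivWithinAt t h1
    rw [FunctionSpaces.Torus.timeDerivWithin]
    exact h3.derivWithin (hU t ht)
  refine hE.congr_deriv ?_
  -- evaluate `∫ β'(θ) ∂ₜθ` with the equation and the two integrations by parts
  have hpt : (fun x => FunctionSpaces.Torus.timeDerivWithin S (fun s x => β (θ s x)) t x) =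
      fun x => κ * (deriv β (θ t x) * FunctionSpaces.Torus.laplacian (θ t) x) -
        deriv β (θ t x) * ⟪u t x, FunctionSpaces.Torus.gradient (θ t) x⟫_ℝ := by
    funext x
    rw [htd x]
    have := h.transport t ht x
    have hre : FunctionSpaces.Torus.timeDerivWithin S θ t x =
        κ * FunctionSpaces.Torus.laplacian (θ t) x - ⟪u t x, FunctionSpaces.Torus.gradient (θ t) x⟫_ℝ := by
      linarith
    rw [hre]
    ring
  have hβθ : FunctionSpaces.Torus.IsSmooth (deriv β ∘ θ t) := hθt.comp_left hβ'
  have i1 : Integrable (fun x => deriv β (θ t x) * FunctionSpaces.Torus.laplacian (θ t) x) volume :=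
    (hβθ.smul' hθt.laplacian).integrable
  have i2 : Integrable (fun x => deriv β (θ t x) * ⟪u t x, FunctionSpaces.Torus.gradient (θ t) x⟫_ℝ)
      volume :=
    (hβθ.smul' (hut.inner hθt.gradient)).integrable
  have hdiv : FunctionSpaces.Torus.IsWeaklyDivFree (u t) := fun φ hφ =>
    integral_inner_gradient_eq_zero_of_isDivFree' hut (h.divFree t ht) hφ
  rw [hpt, integral_sub (i1.const_mul κ) i2, integral_const_mul,
    integral_deriv_comp_mul_laplacian hβ hθt,
    integral_deriv_comp_mul_inner_gradient_eq_zero hβ hθt hdiv]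
  ring

omit [DecidableEq d] in
/-- The renormalised dissipation `∫ β″(θ) ‖∇θ‖²` is nonnegative for convex `β`. [folklore] -/
private theorem integral_deriv_deriv_comp_mul_norm_gradient_sq_nonneg {β : ℝ → ℝ}
    (hβ'' : ∀ s, 0 ≤ deriv (deriv β) s) (θ : UnitAddTorus d → ℝ) :
    0 ≤ ∫ x, deriv (deriv β) (θ x) * ‖FunctionSpaces.Torus.gradient θ x‖ ^ 2 :=
  integral_nonneg fun _ => mul_nonneg (hβ'' _) (sq_nonneg _)

/-- **Convex functionals are Lyapunov functions.** For `κ ≥ 0`, a smooth convex `β` (`β″ ≥ 0`)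
and a classical solution on `S ⊇ [a, b]`, the functional `t ↦ ∫ β(θ(t, x)) dx` is non-increasing
on `[a, b]` (the renormalised balance `hasDerivWithinAt_integral_comp` has a nonpositive
right-hand side). [cite: DiPernaLions1989, §II.3] -/
theorem antitoneOn_integral_comp (h : IsClassicalScalarTransportOn S κ u θ) (hκ : 0 ≤ κ)
    {β : ℝ → ℝ} (hβ : ContDiff ℝ ∞ β) (hβ'' : ∀ s, 0 ≤ deriv (deriv β) s) {a b : ℝ}
    (hS : Icc a b ⊆ S) : AntitoneOn (fun t => ∫ x, β (θ t x)) (Icc a b) := by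
  rcases lt_or_ge a b with hab | hab
  swap
  · intro s hs t ht hst
    have : s = t := le_antisymm hst (le_trans ht.2 (le_trans hab hs.1))
    rw [this]
  have h' := h.restrict_Icc hab hS
  have hconv : Convex ℝ (Icc a b) := convex_Icc a b
  set D : ℝ → ℝ := fun τ =>
    -κ * ∫ x, deriv (deriv β) (θ τ x) * ‖FunctionSpaces.Torus.gradient (θ τ) x‖ ^ 2 with hD
  have hderiv : ∀ τ ∈ Icc a b, HasDerivWithinAt (fun s => ∫ x, β (θ s x)) (D τ) (Icc a b) τ :=
    fun τ hτ => h'.hasDerivWithinAt_integral_comp hconv hβ hτ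
  have hDle : ∀ τ, D τ ≤ 0 := fun τ => by
    rw [hD]
    exact mul_nonpos_of_nonpos_of_nonneg (neg_nonpos.2 hκ)
      (integral_deriv_deriv_comp_mul_norm_gradient_sq_nonneg hβ'' _)
  exact antitoneOn_of_hasDerivWithinAt_nonpos hconv
    (fun τ hτ => (hderiv τ hτ).continuousWithinAt)
    (fun τ hτ => (hderiv τ (interior_subset hτ)).mono interior_subset) fun τ _ => hDle τ

/-- Passage to the limit in the approximation: if `F_ε` are non-increasing on a set and
`G ≤ F_ε ≤ G + ε` pointwise for every `ε > 0`, then `G` is non-increasing there. [folklore] -/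
private theorem antitoneOn_of_forall_approx {D : Set ℝ} {G : ℝ → ℝ} (F : ℝ → ℝ → ℝ)
    (hF : ∀ ε, 0 < ε → AntitoneOn (F ε) D) (hle : ∀ ε, 0 < ε → ∀ t ∈ D, G t ≤ F ε t)
    (hge : ∀ ε, 0 < ε → ∀ t ∈ D, F ε t ≤ G t + ε) : AntitoneOn G D := by
  intro s hs t ht hst
  refine le_of_forall_pos_le_add fun ε hε => ?_
  calc G t ≤ F ε t := hle ε hε t ht
    _ ≤ F ε s := hF ε hε hs ht hst
    _ ≤ G s + ε := hge ε hε s hs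

/-- **The co-signed mass above a level is non-increasing**: for `κ ≥ 0` and a classical solution
on `S ⊇ [a, b]`, `t ↦ ∫ (θ(t, x) - c)⁺ dx` is non-increasing on `[a, b]` for every level `c`
(apply `antitoneOn_integral_comp` to the smooth convex `s ↦ ((s - c) + √((s - c)² + ε²))/2`,
which lies within `ε/2` of `(s - c)⁺` uniformly, and let `ε → 0`). For the vorticity of planar
Navier–Stokes (`κ = ν`, `c = 0`): viscosity never increases the co-signed flux `∫ ω⁺`. Printed
form: Gallay–Wayne 2005, proof of Lemma 3.1 (with Prop. 2.6, the linear equation with a given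
bounded velocity on `ℝ²`): `w⁺(τ) ≤ w₁(τ)` pointwise for the solution `w₁` with datum `w₀⁺`, and
`∫ w₁(τ) = ∫ w₀⁺`; here the periodic classical twin in any dimension and above any level `c`
(constants solve the equation), proved by the renormalised balance instead of the splitting;
the order-preservation / `L¹`-contraction equivalence behind it is Crandall–Tartar 1980,
Prop. 1. [cite: GallayWayne2005, Lemma 3.1] -/
theorem antitoneOn_integral_posPart_sub (h : IsClassicalScalarTransportOn S κ u θ) (hκ : 0 ≤ κ)
    (c : ℝ) {a b : ℝ} (hS : Icc a b ⊆ S) :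
    AntitoneOn (fun t => ∫ x, (θ t x - c)⁺) (Icc a b) := by
  refine antitoneOn_of_forall_approx (fun ε t => ∫ x, (((θ t x - c) + Real.sqrt ((θ t x - c) ^ 2 + ε ^ 2)) / 2)) ?_ ?_ ?_
  · intro ε hε
    have hβ : ContDiff ℝ ∞ (fun s => (((s - c) + Real.sqrt ((s - c) ^ 2 + ε ^ 2)) / 2)) :=
      (contDiff_smoothPos hε.ne').comp (contDiff_id.sub contDiff_const)
    have hβ'' : ∀ s, 0 ≤ deriv (deriv (fun s => (((s - c) + Real.sqrt ((s - c) ^ 2 + ε ^ 2)) / 2))) s := by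
      have hd1 : deriv (fun s => (((s - c) + Real.sqrt ((s - c) ^ 2 + ε ^ 2)) / 2)) = fun s => deriv (fun s => (s + Real.sqrt (s ^ 2 + ε ^ 2)) / 2) (s - c) :=
        funext fun s => deriv_comp_sub_const (fun s => (s + Real.sqrt (s ^ 2 + ε ^ 2)) / 2) c s
      intro s
      rw [hd1, deriv_comp_sub_const (deriv (fun s => (s + Real.sqrt (s ^ 2 + ε ^ 2)) / 2)) c s]
      exact deriv_deriv_smoothPos_nonneg hε.ne' _
    exact h.antitoneOn_integral_comp hκ hβ hβ'' hS
  · intro ε hε t ht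
    have hθt : FunctionSpaces.Torus.IsSmooth (θ t) := h.smooth_scalar.isSmooth_slice (hS ht)
    refine integral_mono_of_nonneg (Eventually.of_forall fun x => posPart_nonneg _) ?_
      (Eventually.of_forall fun x => posPart_le_smoothPos ε _)
    exact (((contDiff_smoothPos hε.ne').continuous).comp
      (hθt.continuous.sub continuous_const)).integrable_unitAddTorus
  · intro ε hε t ht
    have hθt : FunctionSpaces.Torus.IsSmooth (θ t) := h.smooth_scalar.isSmooth_slice (hS ht)
    have hint : Integrable (fun x => (θ t x - c)⁺ + |ε| / 2) (volume : Measure (UnitAddTorus d)) :=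
      ((continuous_posPart.comp (hθt.continuous.sub continuous_const)).integrable_unitAddTorus).add
        (integrable_const _)
    calc ∫ x, (((θ t x - c) + Real.sqrt ((θ t x - c) ^ 2 + ε ^ 2)) / 2)
        ≤ ∫ x, ((θ t x - c)⁺ + |ε| / 2) :=
          integral_mono_of_nonneg
            (Eventually.of_forall fun x => (posPart_nonneg _).trans (posPart_le_smoothPos ε _))
            hint (Eventually.of_forall fun x => smoothPos_le ε _)
      _ = (∫ x, (θ t x - c)⁺) + |ε| / 2 := by
          rw [integral_add _ (integrable_const _), integral_const, probReal_univ, one_smul]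
          exact (continuous_posPart.comp (hθt.continuous.sub continuous_const)).integrable_unitAddTorus
      _ ≤ (∫ x, (θ t x - c)⁺) + ε := by rw [abs_of_pos hε]; linarith

/-- **The co-signed mass `∫ θ⁺` is non-increasing** for `κ ≥ 0` on every `[a, b] ⊆ S` (the case
`c = 0` of `antitoneOn_integral_posPart_sub`). For the scalar vorticity of two-dimensional
Navier–Stokes this is «viscosity never increases the co-signed flux `∫ ω⁺`». [cite: GallayWayne2005, Lemma 3.1] -/
theorem antitoneOn_integral_posPart (h : IsClassicalScalarTransportOn S κ u θ) (hκ : 0 ≤ κ)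
    {a b : ℝ} (hS : Icc a b ⊆ S) : AntitoneOn (fun t => ∫ x, (θ t x)⁺) (Icc a b) := by
  simpa using h.antitoneOn_integral_posPart_sub hκ 0 hS

/-- **The `L¹` norm `∫ |θ(t)|` is non-increasing** for `κ ≥ 0` on every `[a, b] ⊆ S`
(Gallay–Wayne 2005, Lemma 3.1, first assertion — there for `L¹` solutions of the rescaled
two-dimensional vorticity equation on `ℝ²`, "nonincreasing due to the maximum principle"; here
the periodic classical statement in any dimension, via the smooth convex approximations
`√(s² + ε²)` of `|s|`). [cite: GallayWayne2005, Lemma 3.1] -/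
theorem antitoneOn_integral_abs (h : IsClassicalScalarTransportOn S κ u θ) (hκ : 0 ≤ κ)
    {a b : ℝ} (hS : Icc a b ⊆ S) : AntitoneOn (fun t => ∫ x, |θ t x|) (Icc a b) := by
  refine antitoneOn_of_forall_approx (fun ε t => ∫ x, Real.sqrt ((θ t x) ^ 2 + ε ^ 2)) ?_ ?_ ?_
  · intro ε hε
    exact h.antitoneOn_integral_comp hκ (contDiff_smoothAbs hε.ne')
      (deriv_deriv_smoothAbs_nonneg hε.ne') hS
  · intro ε hε t ht
    have hθt : FunctionSpaces.Torus.IsSmooth (θ t) := h.smooth_scalar.isSmooth_slice (hS ht)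
    exact integral_mono_of_nonneg (Eventually.of_forall fun x => abs_nonneg _)
      (((contDiff_smoothAbs hε.ne').continuous.comp hθt.continuous).integrable_unitAddTorus)
      (Eventually.of_forall fun x => abs_le_smoothAbs ε _)
  · intro ε hε t ht
    have hθt : FunctionSpaces.Torus.IsSmooth (θ t) := h.smooth_scalar.isSmooth_slice (hS ht)
    have hi : Integrable (fun x => |θ t x|) (volume : Measure (UnitAddTorus d)) :=
      (continuous_abs.comp hθt.continuous).integrable_unitAddTorus
    calc ∫ x, Real.sqrt ((θ t x) ^ 2 + ε ^ 2)
        ≤ ∫ x, (|θ t x| + |ε|) :=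
          integral_mono_of_nonneg
            (Eventually.of_forall fun x => (abs_nonneg _).trans (abs_le_smoothAbs ε _))
            (hi.add (integrable_const _)) (Eventually.of_forall fun x => smoothAbs_le ε _)
      _ = (∫ x, |θ t x|) + ε := by
          rw [integral_add hi (integrable_const _), integral_const, probReal_univ, one_smul,
            abs_of_pos hε]

/-- **The counter-signed mass `∫ θ⁻` is non-increasing** for `κ ≥ 0` on every `[a, b] ⊆ S`
(`θ⁻ = θ⁺ - θ` pointwise and the mean `∫ θ` is conserved, `scalarMean_eq`). Together with
`antitoneOn_integral_posPart`: viscosity and incompressible transport can only CANCEL the two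
signed masses against each other, never create either (Gallay–Wayne 2005, proof of Lemma 3.1:
`w⁻(τ) ≤ w₂(τ)` with `∫ w₂(τ) = ∫ w₀⁻`, there on `ℝ²`). [cite: GallayWayne2005, Lemma 3.1] -/
theorem antitoneOn_integral_negPart (h : IsClassicalScalarTransportOn S κ u θ) (hκ : 0 ≤ κ)
    {a b : ℝ} (hS : Icc a b ⊆ S) : AntitoneOn (fun t => ∫ x, (θ t x)⁻) (Icc a b) := by
  have hrepr : ∀ t ∈ Icc a b, ∫ x, (θ t x)⁻ = (∫ x, (θ t x)⁺) - scalarMean (θ a) := by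
    intro t ht
    have hθt : FunctionSpaces.Torus.IsSmooth (θ t) := h.smooth_scalar.isSmooth_slice (hS ht)
    have hp : Integrable (fun x => (θ t x)⁺) (volume : Measure (UnitAddTorus d)) :=
      (continuous_posPart.comp hθt.continuous).integrable_unitAddTorus
    have e : (fun x => (θ t x)⁻) = fun x => (θ t x)⁺ - θ t x := by
      funext x
      have := posPart_sub_negPart (θ t x)
      linarith
    rw [← h.scalarMean_eq hS ht, scalarMean, e, integral_sub hp hθt.integrable]
  intro s hs t ht hst
  dsimp only
  rw [hrepr s hs, hrepr t ht]
  exact sub_le_sub_right (h.antitoneOn_integral_posPart hκ hS hs ht hst) _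

/-! ## Linearity: the difference of two solutions, and the `L¹`-contraction -/

omit [DecidableEq d] in
/-- `D(f - g)(x) = Df(x) - Dg(x)` for `C¹` functions on the torus (Mathlib `fderiv_sub` on the
re-centred lifts; the tree's `Torus.fderiv_add` pattern). [folklore] -/
private theorem fderiv_sub_apply' {f g : UnitAddTorus d → ℝ} (hf : FunctionSpaces.Torus.IsContDiff 1 f)
    (hg : FunctionSpaces.Torus.IsContDiff 1 g) (x : UnitAddTorus d) (w : EuclideanSpace ℝ d) :
    FunctionSpaces.Torus.fderiv (fun y => f y - g y) x w =
      FunctionSpaces.Torus.fderiv f x w - FunctionSpaces.Torus.fderiv g x w := by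
  unfold FunctionSpaces.Torus.fderiv
  rw [show FunctionSpaces.Torus.liftAt (fun y => f y - g y) x =
      FunctionSpaces.Torus.liftAt f x - FunctionSpaces.Torus.liftAt g x from rfl,
    _root_.fderiv_sub ((hf.liftAt x).differentiable one_ne_zero).differentiableAt
      ((hg.liftAt x).differentiable one_ne_zero).differentiableAt]
  rfl

omit [DecidableEq d] in
/-- `∇(f - g)(x) = ∇f(x) - ∇g(x)` for `C¹` scalars on the torus. [folklore] -/
private theorem gradient_sub_apply' {f g : UnitAddTorus d → ℝ} (hf : FunctionSpaces.Torus.IsContDiff 1 f)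
    (hg : FunctionSpaces.Torus.IsContDiff 1 g) (x : UnitAddTorus d) :
    FunctionSpaces.Torus.gradient (fun y => f y - g y) x =
      FunctionSpaces.Torus.gradient f x - FunctionSpaces.Torus.gradient g x := by
  refine ext_inner_right ℝ fun w => ?_
  rw [inner_sub_left, FunctionSpaces.Torus.inner_gradient_left, FunctionSpaces.Torus.inner_gradient_left,
    FunctionSpaces.Torus.inner_gradient_left, fderiv_sub_apply' hf hg]

omit [DecidableEq d] in
/-- `Δ(f - g)(x) = Δf(x) - Δg(x)` for smooth functions on the torus (Mathlib
`ContDiffAt.laplacian_sub` on the re-centred lifts). [folklore] -/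
private theorem laplacian_sub_apply' {f g : UnitAddTorus d → ℝ} (hf : FunctionSpaces.Torus.IsSmooth f)
    (hg : FunctionSpaces.Torus.IsSmooth g) (x : UnitAddTorus d) :
    FunctionSpaces.Torus.laplacian (fun y => f y - g y) x =
      FunctionSpaces.Torus.laplacian f x - FunctionSpaces.Torus.laplacian g x := by
  unfold FunctionSpaces.Torus.laplacian
  rw [show FunctionSpaces.Torus.liftAt (fun y => f y - g y) x =
      FunctionSpaces.Torus.liftAt f x - FunctionSpaces.Torus.liftAt g x from rfl]
  rw [((hf.isContDiff (n := 2) (by decide)).liftAt x).contDiffAt.laplacian_sub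
    ((hg.isContDiff (n := 2) (by decide)).liftAt x).contDiffAt]

/-- **Linearity.** The difference of two classical solutions with the same drift on a time set of
unique differentiability is a classical solution (the equation is linear in `θ`; Gallay–Wayne
2005, proof of Lemma 3.1: "by construction we have `w = w₁ - w₂`" for the solutions `w₁, w₂` of
the linear equation with the same velocity). [cite: GallayWayne2005, proof of Lemma 3.1] -/
theorem sub (hU : UniqueDiffOn ℝ S) {θ₁ θ₂ : ℝ → UnitAddTorus d → ℝ}
    (h₁ : IsClassicalScalarTransportOn S κ u θ₁) (h₂ : IsClassicalScalarTransportOn S κ u θ₂) :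
    IsClassicalScalarTransportOn S κ u (fun t x => θ₁ t x - θ₂ t x) := by
  refine ⟨h₁.smooth_velocity, h₁.smooth_scalar.sub h₂.smooth_scalar, fun t ht x => ?_, h₁.divFree⟩
  have e₁ := h₁.transport t ht x
  have e₂ := h₂.transport t ht x
  have hθ₁ : FunctionSpaces.Torus.IsSmooth (θ₁ t) := h₁.smooth_scalar.isSmooth_slice ht
  have hθ₂ : FunctionSpaces.Torus.IsSmooth (θ₂ t) := h₂.smooth_scalar.isSmooth_slice ht
  have htd : FunctionSpaces.Torus.timeDerivWithin S (fun t x => θ₁ t x - θ₂ t x) t x =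
      FunctionSpaces.Torus.timeDerivWithin S θ₁ t x - FunctionSpaces.Torus.timeDerivWithin S θ₂ t x := by
    have hd := (h₁.smooth_scalar.hasDerivWithinAt_slice ht x).sub
      (h₂.smooth_scalar.hasDerivWithinAt_slice ht x)
    rw [FunctionSpaces.Torus.timeDerivWithin]
    exact hd.derivWithin (hU t ht)
  rw [htd, gradient_sub_apply' (hθ₁.isContDiff (by decide)) (hθ₂.isContDiff (by decide)),
    laplacian_sub_apply' hθ₁ hθ₂,
    inner_sub_right]
  linarith

/-- **`L¹`-contraction.** For two classical solutions `θ₁, θ₂` with the same divergence-free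
drift and `κ ≥ 0` on `S ⊇ [a, b]`, the `L¹`-distance `∫ |θ₁(t) - θ₂(t)|` is non-increasing on
`[a, b]` (`antitoneOn_integral_abs` for the difference, a solution by linearity; the
`L¹`-contraction / order-preservation pairing of Crandall–Tartar 1980, Prop. 1, for the
mass-preserving solution map — here both properties are proved directly; Gallay–Wayne's
Lemma 3.1 is stated for one solution of the linear equation with a given velocity, Prop. 2.6,
which covers differences). [cite: GallayWayne2005, Lemma 3.1] -/
theorem antitoneOn_integral_abs_sub {θ₁ θ₂ : ℝ → UnitAddTorus d → ℝ}
    (h₁ : IsClassicalScalarTransportOn S κ u θ₁) (h₂ : IsClassicalScalarTransportOn S κ u θ₂)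
    (hκ : 0 ≤ κ) {a b : ℝ} (hS : Icc a b ⊆ S) :
    AntitoneOn (fun t => ∫ x, |θ₁ t x - θ₂ t x|) (Icc a b) := by
  rcases lt_or_ge a b with hab | hab
  swap
  · intro s hs t ht hst
    have : s = t := le_antisymm hst (le_trans ht.2 (le_trans hab hs.1))
    rw [this]
  exact (sub (uniqueDiffOn_Icc hab) (h₁.restrict_Icc hab hS) (h₂.restrict_Icc hab hS)).antitoneOn_integral_abs
    hκ Subset.rfl

end IsClassicalScalarTransportOn

end Torus

end Literature.Analysis.FluidPDE
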